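import Summits.Ventures.LatticeQCDFlow.Exactness.AcceptanceFromMeanEnergyViolation
import Summits.Ventures.LatticeQCDFlow.Exactness.Phi4LeapfrogGrowth
import Mathlib.Algebra.Order.Chebyshev
import HarnessLib

/-!
# The leapfrog energy violation of lattice φ⁴ HMC has a finite first moment: `∫ |ΔH| e^{−H} < ∞`

HONEST FRAMING: exact (Metropolis-corrected) sampling algorithms for lattice gauge theory;
figures of merit are autocorrelation/cost numbers at stated couplings and volumes; no
continuum-physics claim.  (SCALAR calibration rung S0-A: not a gauge result.)

Venture `LatticeQCDFlow` (cell pub-lqcd), topic `Exactness`; FANOUT row 2 (`s0-phi4`, HMC arm).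
NEW WORK of the cell over Mathlib (`pow_sum_le_card_mul_sum_pow`, `add_pow_le`: Jensen for powers
of sums) and row 2's files (`Exactness/Phi4LeapfrogGrowth.lean`: `|ΔH| ≤ C s^{2·4^N}`;
`Scoring/SchwingerDysonPhi4GibbsMonomial.lean`: all single-site Gibbs moments exist under
coercivity; `Exactness/Phi4HMCExact.lean`: the kinetic weight is a coercive Gibbs weight); nothing
is cited as a fact.

`Exactness/AcceptanceFromMeanEnergyViolation.lean` (row 2) proved the model-free acceptance bound
`∫ min(1, e^{−ΔH}) e^{−H} ≥ (1 − √(1 − e^{−⟨ΔH⟩})) Z` for row 2's lattice HMC ASSUMING the first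
moment `∫ ΔH e^{−H}` exists (`hmc_acceptance_ge`, hypothesis `hΔ`).  This file DISCHARGES it.

* `integrable_phaseSize_pow_mul_exp_neg` — under a coercive action every power `s^{m+1} e^{−H}`
  is integrable on phase space (Jensen reduces `s^{m+1}` to `4^m (1 + (n+1)^m Σ_x φ_x^{2m+2} +
  (n+1)^m Σ_x p_x^{2m+2})`, and the single-site moments are products of integrable factors);
* **`integrable_hmcDeltaH_mul_exp_neg`** — `ΔH · e^{−H}` is integrable for every coercive
  `(λ, J)` (all `λ > 0`, any real `J`), every `δ`, `N`;
* **`hmc_acceptance_ge'`**, **`hmc_acceptance_ge_phi4`** — the acceptance bound, UNCONDITIONAL: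
  `∫ min(1, e^{−ΔH}) e^{−H} ≥ (1 − √(1 − exp(−⟨ΔH⟩))) · Z` for every `λ > 0`, real `J`, `δ`, `N`.
NOT CLAIMED: quantitative constants; higher moments (the same argument gives them verbatim).
-/

namespace Summit.Ventures.LatticeQCDFlow.Exactness

open Real MeasureTheory Filter Finset
open Summit.Ventures.LatticeQCDFlow.Scoring

variable {n : ℕ}

/-! ## Polynomial moments of `e^{−H}` and the conclusion -/

/-- **Every power of the size is integrable against `e^{−H}`** under a coercive action. -/
theorem integrable_phaseSize_pow_mul_exp_neg {J : Fin (n + 1) → Fin (n + 1) → ℝ} {lam ε K : ℝ}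
    (hε : 0 < ε) (hS : ∀ φ : Fin (n + 1) → ℝ, ε * ∑ w, φ w ^ 2 - K ≤ latticePhi4Action J lam φ)
    (m : ℕ) :
    Integrable (fun z => phaseSize z ^ (m + 1) * Real.exp (-phi4HmcEnergy J lam z))
      ((volume : Measure (Fin (n + 1) → ℝ)).prod volume) := by
  -- the kinetic weight is a coercive Gibbs weight too
  have hSp : ∀ p : Fin (n + 1) → ℝ, (1 / 2) * ∑ w, p w ^ 2 - 0 ≤ latticePhi4Action (halfDiag n) 0 p :=
    fun p => by rw [latticePhi4Action_halfDiag]; linarith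
  have hwφ := integrable_gibbsWeight_of_coercive hε hS
  have hwp : Integrable (momentumWeight (n := n)) := integrable_momentumWeight
  -- single-site even moments, as products on phase space
  have hφ : ∀ x, Integrable (fun z : (Fin (n + 1) → ℝ) × (Fin (n + 1) → ℝ) =>
      (z.1 x ^ (2 * (m + 1)) * gibbsWeight J lam z.1) * momentumWeight z.2)
      ((volume : Measure (Fin (n + 1) → ℝ)).prod volume) := fun x => by
    have h := integrable_pow_mul_pow_mul_gibbsWeight_of_coercive hε hS x x (2 * (m + 1)) 0
    simp only [pow_zero, mul_one] at h
    exact h.mul_prod hwp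
  have hp : ∀ x, Integrable (fun z : (Fin (n + 1) → ℝ) × (Fin (n + 1) → ℝ) =>
      gibbsWeight J lam z.1 * (z.2 x ^ (2 * (m + 1)) * momentumWeight z.2))
      ((volume : Measure (Fin (n + 1) → ℝ)).prod volume) := fun x => by
    have h := integrable_pow_mul_pow_mul_gibbsWeight_of_coercive (by norm_num : (0 : ℝ) < 1 / 2)
      hSp x x (2 * (m + 1)) 0
    simp only [pow_zero, mul_one] at h
    have h' : Integrable (fun p : Fin (n + 1) → ℝ => p x ^ (2 * (m + 1)) * momentumWeight p) :=
      h.congr (Eventually.of_forall fun p => by simp only [momentumWeight_eq_gibbsWeight])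
    exact hwφ.mul_prod h'
  have h0 : Integrable (fun z : (Fin (n + 1) → ℝ) × (Fin (n + 1) → ℝ) =>
      gibbsWeight J lam z.1 * momentumWeight z.2)
      ((volume : Measure (Fin (n + 1) → ℝ)).prod volume) := hwφ.mul_prod hwp
  -- the dominating function
  set c₃ : ℝ := (4 : ℝ) ^ m with hc₃
  set cₙ : ℝ := ((n : ℝ) + 1) ^ m with hcₙ
  have hdom : Integrable (fun z : (Fin (n + 1) → ℝ) × (Fin (n + 1) → ℝ) =>
      c₃ * (gibbsWeight J lam z.1 * momentumWeight z.2
        + cₙ * ∑ x, (z.1 x ^ (2 * (m + 1)) * gibbsWeight J lam z.1) * momentumWeight z.2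
        + cₙ * ∑ x, gibbsWeight J lam z.1 * (z.2 x ^ (2 * (m + 1)) * momentumWeight z.2)))
      ((volume : Measure (Fin (n + 1) → ℝ)).prod volume) :=
    ((h0.add ((integrable_finsetSum _ fun x _ => hφ x).const_mul _)).add
      ((integrable_finsetSum _ fun x _ => hp x).const_mul _)).const_mul _
  refine Integrable.mono' hdom ?_ (Eventually.of_forall fun z => ?_)
  · refine ((Measurable.pow_const ?_ _).mul
      (Real.measurable_exp.comp (measurable_phi4HmcEnergy J lam).neg)).aestronglyMeasurable
    unfold phaseSize
    fun_prop
  -- the pointwise bound `s^{m+1} e^{−H} ≤ 4^m (1 + (n+1)^m Σ φ_x^{2m+2} + (n+1)^m Σ p_x^{2m+2}) e^{−H}`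
  have hs0 : 0 ≤ phaseSize z := (phaseSize_pos z).le
  rw [Real.norm_eq_abs, abs_mul, abs_of_nonneg (pow_nonneg hs0 _), abs_of_pos (Real.exp_pos _),
    exp_neg_phi4HmcEnergy]
  set a := ∑ x, z.1 x ^ 2 with ha_def
  set b := ∑ x, z.2 x ^ 2 with hb_def
  have ha : 0 ≤ a := sum_nonneg fun _ _ => sq_nonneg _
  have hb : 0 ≤ b := sum_nonneg fun _ _ => sq_nonneg _
  -- Jensen for the three summands of `s = 1 + a + b`
  have h3 : phaseSize z ^ (m + 1) ≤ c₃ * (1 + a ^ (m + 1) + b ^ (m + 1)) := by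
    have h3a := add_pow_le (add_nonneg zero_le_one ha) hb (m + 1)
    have h3b := add_pow_le zero_le_one ha (m + 1)
    simp only [Nat.add_sub_cancel, one_pow] at h3a h3b
    have h2m : (0 : ℝ) ≤ 2 ^ m := by positivity
    have h2m1 : (1 : ℝ) ≤ 2 ^ m := one_le_pow₀ (by norm_num)
    have hbm : 0 ≤ b ^ (m + 1) := pow_nonneg hb _
    have ham : 0 ≤ a ^ (m + 1) := pow_nonneg ha _
    have e4 : c₃ = 2 ^ m * 2 ^ m := by rw [hc₃, ← mul_pow]; norm_num
    have hsz : phaseSize z = 1 + a + b := rfl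
    rw [hsz, e4]
    calc (1 + a + b) ^ (m + 1) ≤ 2 ^ m * ((1 + a) ^ (m + 1) + b ^ (m + 1)) := h3a
      _ ≤ 2 ^ m * (2 ^ m * (1 + a ^ (m + 1)) + b ^ (m + 1)) := by
          refine mul_le_mul_of_nonneg_left ?_ h2m
          linarith
      _ ≤ 2 ^ m * 2 ^ m * (1 + a ^ (m + 1) + b ^ (m + 1)) := by
          have hb2 : b ^ (m + 1) ≤ 2 ^ m * b ^ (m + 1) := le_mul_of_one_le_left hbm h2m1
          have h4 := mul_le_mul_of_nonneg_left hb2 h2m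
          linarith
  -- Jensen for the site sums
  have hJφ : a ^ (m + 1) ≤ cₙ * ∑ x, z.1 x ^ (2 * (m + 1)) := by
    have h := pow_sum_le_card_mul_sum_pow (s := (univ : Finset (Fin (n + 1))))
      (f := fun x => z.1 x ^ 2) (fun _ _ => sq_nonneg _) m
    simp only [card_univ, Fintype.card_fin, ← pow_mul] at h
    push_cast at h
    rw [hcₙ, ha_def]
    exact h
  have hJp : b ^ (m + 1) ≤ cₙ * ∑ x, z.2 x ^ (2 * (m + 1)) := by
    have h := pow_sum_le_card_mul_sum_pow (s := (univ : Finset (Fin (n + 1))))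
      (f := fun x => z.2 x ^ 2) (fun _ _ => sq_nonneg _) m
    simp only [card_univ, Fintype.card_fin, ← pow_mul] at h
    push_cast at h
    rw [hcₙ, hb_def]
    exact h
  have hw0 : 0 ≤ gibbsWeight J lam z.1 * momentumWeight z.2 :=
    mul_nonneg (gibbsWeight_pos J lam z.1).le (Real.exp_pos _).le
  have hc₃0 : 0 ≤ c₃ := by positivity
  have key : phaseSize z ^ (m + 1)
      ≤ c₃ * (1 + cₙ * ∑ x, z.1 x ^ (2 * (m + 1)) + cₙ * ∑ x, z.2 x ^ (2 * (m + 1))) :=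
    h3.trans (mul_le_mul_of_nonneg_left (by linarith) hc₃0)
  have e : c₃ * (gibbsWeight J lam z.1 * momentumWeight z.2
        + cₙ * ∑ x, (z.1 x ^ (2 * (m + 1)) * gibbsWeight J lam z.1) * momentumWeight z.2
        + cₙ * ∑ x, gibbsWeight J lam z.1 * (z.2 x ^ (2 * (m + 1)) * momentumWeight z.2))
      = c₃ * (1 + cₙ * ∑ x, z.1 x ^ (2 * (m + 1)) + cₙ * ∑ x, z.2 x ^ (2 * (m + 1)))
        * (gibbsWeight J lam z.1 * momentumWeight z.2) := by
    rw [← sum_mul, ← sum_mul, ← mul_sum, ← sum_mul]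
    ring
  rw [e]
  exact mul_le_mul_of_nonneg_right key hw0

/-- **THE FIRST MOMENT OF THE ENERGY VIOLATION EXISTS**: `ΔH · e^{−H}` is integrable on phase
space for row 2's HMC (coercive action; every `J`, `δ`, `N`). -/
theorem integrable_hmcDeltaH_mul_exp_neg {J : Fin (n + 1) → Fin (n + 1) → ℝ} {lam ε K : ℝ}
    (hε : 0 < ε) (hS : ∀ φ : Fin (n + 1) → ℝ, ε * ∑ w, φ w ^ 2 - K ≤ latticePhi4Action J lam φ)
    (δ : ℝ) (N : ℕ) :
    Integrable (fun z => hmcDeltaH J lam δ N z * Real.exp (-phi4HmcEnergy J lam z))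
      ((volume : Measure (Fin (n + 1) → ℝ)).prod volume) := by
  obtain ⟨C, hC0, hC⟩ := abs_hmcDeltaH_le J lam δ N
  obtain ⟨m, hm⟩ : ∃ m : ℕ, 2 * 4 ^ N = m + 1 := ⟨2 * 4 ^ N - 1, by
    have : 1 ≤ 2 * 4 ^ N := by nlinarith [Nat.one_le_pow N 4 (by norm_num)]
    omega⟩
  have hdom := (integrable_phaseSize_pow_mul_exp_neg hε hS m).const_mul C
  refine Integrable.mono' hdom ?_ (Eventually.of_forall fun z => ?_)
  · have hΔm : Measurable (hmcDeltaH J lam δ N) :=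
      measurable_deltaH (measurable_phi4HmcEnergy J lam) (measurable_hmcProposal J lam δ N)
    exact (hΔm.mul (Real.measurable_exp.comp (measurable_phi4HmcEnergy J lam).neg)).aestronglyMeasurable
  · rw [Real.norm_eq_abs, abs_mul, abs_of_pos (Real.exp_pos _), ← hm, ← mul_assoc]
    exact mul_le_mul_of_nonneg_right (hC z) (Real.exp_pos _).le

/-- **THE MODEL-FREE ACCEPTANCE BOUND FOR ROW 2'S HMC, UNCONDITIONALLY** (coercive action, every
`δ`, `N`): `∫ min(1, e^{−ΔH}) e^{−H} ≥ (1 − √(1 − exp(−⟨ΔH⟩))) · Z`, `⟨ΔH⟩ = Z⁻¹ ∫ ΔH e^{−H}`. -/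
theorem hmc_acceptance_ge' {J : Fin (n + 1) → Fin (n + 1) → ℝ} {lam ε K : ℝ} (hε : 0 < ε)
    (hS : ∀ φ : Fin (n + 1) → ℝ, ε * ∑ w, φ w ^ 2 - K ≤ latticePhi4Action J lam φ)
    (δ : ℝ) (N : ℕ) :
    (1 - Real.sqrt (1 - Real.exp (-((∫ z, hmcDeltaH J lam δ N z * Real.exp (-phi4HmcEnergy J lam z)
        ∂((volume : Measure (Fin (n + 1) → ℝ)).prod volume))
        / ∫ z, Real.exp (-phi4HmcEnergy J lam z) ∂((volume : Measure (Fin (n + 1) → ℝ)).prod volume)))))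
      * ∫ z, Real.exp (-phi4HmcEnergy J lam z) ∂((volume : Measure (Fin (n + 1) → ℝ)).prod volume)
      ≤ ∫ z, min 1 (Real.exp (-hmcDeltaH J lam δ N z)) * Real.exp (-phi4HmcEnergy J lam z)
          ∂((volume : Measure (Fin (n + 1) → ℝ)).prod volume) :=
  hmc_acceptance_ge hε hS δ N (integrable_hmcDeltaH_mul_exp_neg hε hS δ N)

/-- **Every `λ > 0`, every real `J`, every `δ`, `N`.** -/
theorem hmc_acceptance_ge_phi4 {lam : ℝ} (hlam : 0 < lam) (J : Fin (n + 1) → Fin (n + 1) → ℝ)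
    (δ : ℝ) (N : ℕ) :
    (1 - Real.sqrt (1 - Real.exp (-((∫ z, hmcDeltaH J lam δ N z * Real.exp (-phi4HmcEnergy J lam z)
        ∂((volume : Measure (Fin (n + 1) → ℝ)).prod volume))
        / ∫ z, Real.exp (-phi4HmcEnergy J lam z) ∂((volume : Measure (Fin (n + 1) → ℝ)).prod volume)))))
      * ∫ z, Real.exp (-phi4HmcEnergy J lam z) ∂((volume : Measure (Fin (n + 1) → ℝ)).prod volume)
      ≤ ∫ z, min 1 (Real.exp (-hmcDeltaH J lam δ N z)) * Real.exp (-phi4HmcEnergy J lam z)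
          ∂((volume : Measure (Fin (n + 1) → ℝ)).prod volume) :=
  hmc_acceptance_ge' one_pos (latticePhi4Action_coercive hlam J) δ N

end Summit.Ventures.LatticeQCDFlow.Exactness
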